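import Summits.AnomalousDissipation.AnomalousDissipation.Theorems.MomentParityQuarticGateAxialQuadForms
import Summits.AnomalousDissipation.AnomalousDissipation.Theorems.MomentParityQuarticGateAxialQuadPol
import Summits.AnomalousDissipation.AnomalousDissipation.Theorems.MomentParityQuarticGateAxialQuadSteps
import Summits.AnomalousDissipation.AnomalousDissipation.Theorems.MomentParityQuarticGateModeCalculus
import Summits.AnomalousDissipation.AnomalousDissipation.Theorems.MomentParityQuarticGateDesignSymShift
import Summits.AnomalousDissipation.AnomalousDissipation.Theorems.MomentParityQuarticGateFourierDictionaryPart3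

/-!
# Axial quadratic rigidity (stub S2q of line `axis-sectors`, crux `MomentParity.QuarticGate`):
# the Hessian blocks — support, symmetry, transversality, and AXIALITY from shear invariance

The blocks `Q a b = Σᵢⱼ hᵢⱼ ĝᵢ(-a) ĝⱼ(-b)ᵀ` of `p = P((·, g))` (band tests `g`) are supported in the
punctured ball, symmetric and transverse; if `p` is invariant under the shear group
`H_L = {a | a 1 = 0, L • a = 0}` on level-`N` fields with `L > 2N`, they are AXIAL
(`Q a b ≠ 0 ⟹ a + b ∈ ℤe₁`): Nyquist `|(a+b)ᵢ| ≤ 2N < L`, one character of `H_L` detects a non-axial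
momentum, and the invariance defect is polarised/complexified and probed one-sidedly.
-/

namespace Summit.AnomalousDissipation.AnomalousDissipation.Theorems.MomentParityQuarticGate.AxialQuad

open scoped InnerProductSpace ComplexConjugate
open Matrix
open Literature.Analysis.FunctionSpaces Literature.Analysis.FluidPDE
open Summit.AnomalousDissipation.AnomalousDissipation.Theorems.QuarticGate.Negative

-- `Summit.<Summit>.<Problem>` is the tree's mandated summit-side namespace (CONVENTIONS §2); for this
-- single-conjunct summit the two coincide, so the duplicate is deliberate.
set_option linter.dupNamespace false

noncomputable section

/-! ## Structural properties of the Hessian blocks -/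

section Structure

variable {N m : ℕ} (g : Fin m → UnitAddTorus (Fin 3) → EuclideanSpace ℝ (Fin 3))
  (P : MvPolynomial (Fin m) ℝ)

/-- **Symmetry**: `Q b a = (Q a b)ᵀ`. [folklore] -/
theorem hessianBlock_transpose (a b : Fin 3 → ℤ) : (∑ i, ∑ j, (((MvPolynomial.pderiv j (MvPolynomial.pderiv i P)).coeff 0 : ℝ) : ℂ) • Matrix.vecMulVec (WithLp.ofLp (tcoef (g i) (-(b)))) (WithLp.ofLp (tcoef (g j) (-(a))))) = ((∑ i, ∑ j, (((MvPolynomial.pderiv j (MvPolynomial.pderiv i P)).coeff 0 : ℝ) : ℂ) • Matrix.vecMulVec (WithLp.ofLp (tcoef (g i) (-(a)))) (WithLp.ofLp (tcoef (g j) (-(b))))))ᵀ := by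
  rw [Matrix.transpose_sum, Finset.sum_comm]
  refine Finset.sum_congr rfl fun i _ => ?_
  rw [Matrix.transpose_sum]
  refine Finset.sum_congr rfl fun j _ => ?_
  rw [Matrix.transpose_smul, Matrix.transpose_vecMulVec, AxialQuad.hessian_symm P i j]

/-- **Support**: the blocks vanish off the punctured ball (band tests). [folklore] -/
theorem hessianBlock_eq_zero_of_not_mem (hg : ∀ i, IsBandTest N (g i)) {a b : Fin 3 → ℤ}
    (h : a ∉ (Torus.freqBall N).erase 0 ∨ b ∉ (Torus.freqBall N).erase 0) : (∑ i, ∑ j, (((MvPolynomial.pderiv j (MvPolynomial.pderiv i P)).coeff 0 : ℝ) : ℂ) • Matrix.vecMulVec (WithLp.ofLp (tcoef (g i) (-(a)))) (WithLp.ofLp (tcoef (g j) (-(b))))) = 0 := by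
  have hn : ∀ k : Fin 3 → ℤ, k ∉ (Torus.freqBall N).erase 0 → -k ∉ (Torus.freqBall N).erase 0 :=
    fun k hk h => hk (by simpa using neg_mem_freqBall_erase_zero (-k) h)
  refine Finset.sum_eq_zero fun i _ => Finset.sum_eq_zero fun j _ => ?_
  rcases h with h | h
  · rw [show tcoef (g i) (-a) = 0 from (hg i).2.2.2 _ (hn a h), WithLp.ofLp_zero, Matrix.zero_vecMulVec, smul_zero]
  · rw [show tcoef (g j) (-b) = 0 from (hg j).2.2.2 _ (hn b h), WithLp.ofLp_zero, Matrix.vecMulVec_zero, smul_zero]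

/-- Transversality of a band test's coefficient, bilinear form: `a · ĝ(-a) = 0`. [folklore] -/
theorem castVec_dotProduct_tcoef_neg (hg : ∀ i, IsBandTest N (g i)) (i : Fin m) (a : Fin 3 → ℤ) :
    (fun i : Fin 3 => (((a : Fin 3 → ℤ) i : ℤ) : ℂ)) ⬝ᵥ WithLp.ofLp (tcoef (g i) (-a)) = 0 := by
  have h := sum_mul_tcoef_eq_zero (hg i).1 (hg i).2.1 (-a)
  have e : ∀ l, (fun i : Fin 3 => (((a : Fin 3 → ℤ) i : ℤ) : ℂ)) l * WithLp.ofLp (tcoef (g i) (-a)) l =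
      -((((-a) l : ℤ) : ℂ) * (tcoef (g i) (-a)) l) := fun l => by
    simp only [Pi.neg_apply, Int.cast_neg, neg_mul, neg_neg]
  rw [dotProduct, Finset.sum_congr rfl fun l _ => e l, Finset.sum_neg_distrib, h, neg_zero]

/-- **Row transversality**: `aᵀ Q a b = 0`. [folklore] -/
theorem hessianBlock_row (hg : ∀ i, IsBandTest N (g i)) (a b : Fin 3 → ℤ) : (fun i : Fin 3 => (((a : Fin 3 → ℤ) i : ℤ) : ℂ)) ᵥ* (∑ i, ∑ j, (((MvPolynomial.pderiv j (MvPolynomial.pderiv i P)).coeff 0 : ℝ) : ℂ) • Matrix.vecMulVec (WithLp.ofLp (tcoef (g i) (-(a)))) (WithLp.ofLp (tcoef (g j) (-(b))))) = 0 := by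
  rw [Matrix.vecMul_sum]
  refine Finset.sum_eq_zero fun i _ => ?_
  rw [Matrix.vecMul_sum]
  refine Finset.sum_eq_zero fun j _ => ?_
  rw [Matrix.vecMul_smul, Matrix.vecMul_vecMulVec, castVec_dotProduct_tcoef_neg g hg, zero_smul, smul_zero]

/-- **Column transversality**: `Q a b b = 0`. [folklore] -/
theorem hessianBlock_col (hg : ∀ i, IsBandTest N (g i)) (a b : Fin 3 → ℤ) : (∑ i, ∑ j, (((MvPolynomial.pderiv j (MvPolynomial.pderiv i P)).coeff 0 : ℝ) : ℂ) • Matrix.vecMulVec (WithLp.ofLp (tcoef (g i) (-(a)))) (WithLp.ofLp (tcoef (g j) (-(b))))) *ᵥ (fun i : Fin 3 => (((b : Fin 3 → ℤ) i : ℤ) : ℂ)) = 0 := by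
  have h := hessianBlock_row g P hg b a
  rw [hessianBlock_transpose, Matrix.vecMul_transpose] at h
  exact h

/-- A block transverse in rows and columns that is killed by all transverse test vectors on both
sides vanishes. [folklore] -/
theorem matrix_eq_zero_of_transverse_forms {a b : Fin 3 → ℤ} (ha : a ≠ 0) (hb : b ≠ 0)
    (M : Matrix (Fin 3) (Fin 3) ℂ) (hrow : (fun i : Fin 3 => (((a : Fin 3 → ℤ) i : ℤ) : ℂ)) ᵥ* M = 0) (hcol : M *ᵥ (fun i : Fin 3 => (((b : Fin 3 → ℤ) i : ℤ) : ℂ)) = 0)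
    (h : ∀ v w : Fin 3 → ℂ, v ⬝ᵥ (fun i : Fin 3 => (((a : Fin 3 → ℤ) i : ℤ) : ℂ)) = 0 → w ⬝ᵥ (fun i : Fin 3 => (((b : Fin 3 → ℤ) i : ℤ) : ℂ)) = 0 → v ⬝ᵥ (M *ᵥ w) = 0) : M = 0 := by
  refine AxialQuad.matrix_eq_zero_of_mulVec_transverse b hb M hcol fun w hw => ?_
  refine AxialQuad.eq_zero_of_dotProduct_transverse a ha _ (fun v hv => h v w hv hw) ?_
  rw [Matrix.dotProduct_mulVec, hrow, zero_dotProduct]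

end Structure

/-! ## One character of the shear group detects a non-axial momentum -/

section Character

/-- **A non-axial frequency below Nyquist is detected by a shear character**: if
`|q₀|, |q₂| < L` and `(q₀, q₂) ≠ 0` then some `a ∈ H_L` has `e_q(a) ≠ 1` (`L ≥ 2`). [folklore] -/
theorem exists_shear_char_ne_one {L : ℕ} (hL : 2 ≤ L) (q : Fin 3 → ℤ) (h0 : |q 0| < L) (h2 : |q 2| < L)
    (hq : ¬ (q 0 = 0 ∧ q 2 = 0)) :
    ∃ a : UnitAddTorus (Fin 3), a 1 = 0 ∧ L • a = 0 ∧ (UnitAddTorus.mFourier q a : ℂ) ≠ 1 := by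
  have hLpos : 0 < L := by omega
  have hL0 : (L : ℂ) ≠ 0 := by exact_mod_cast hLpos.ne'
  have h2pi : (2 * Real.pi * Complex.I : ℂ) ≠ 0 := by simp [Real.pi_ne_zero, Complex.I_ne_zero]
  -- the character value at the grid point `j` and its non-triviality
  have key : ∀ (c : ℤ) (hc : |c| < L) (hc0 : c ≠ 0),
      Complex.exp (2 * Real.pi * Complex.I * c * (((1 : ℕ) : ℕ) : ℝ) / L) ≠ 1 := by
    intro c hc hc0 he
    obtain ⟨n, hn⟩ := Complex.exp_eq_one_iff.1 he
    have hc' : (c : ℂ) = n * L := by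
      field_simp at hn
      push_cast at hn
      linear_combination hn
    have hcn : c = n * L := by exact_mod_cast hc'
    exact hc0 (Int.eq_zero_of_abs_lt_dvd ⟨n, by rw [hcn, mul_comm]⟩ hc)
  by_cases hq0 : q 0 = 0
  · have hq2 : q 2 ≠ 0 := fun h => hq ⟨hq0, h⟩
    refine ⟨fun i => ((((![((⟨0, hLpos⟩ : Fin L) : ℕ), 0, ((⟨1, hL⟩ : Fin L) : ℕ)] : Fin 3 → ℕ) i : ℝ) / L : ℝ) :
      UnitAddCircle), ?_, ?_, ?_⟩
    · exact ((shearGrid_iff hLpos _).2 ⟨(⟨0, hLpos⟩, ⟨1, hL⟩), rfl⟩).1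
    · exact ((shearGrid_iff hLpos _).2 ⟨(⟨0, hLpos⟩, ⟨1, hL⟩), rfl⟩).2
    · rw [mFourier_shearGrid q (⟨0, hLpos⟩, ⟨1, hL⟩)]
      simp only [Nat.cast_zero, mul_zero, zero_div, Complex.ofReal_zero, Complex.exp_zero, one_mul]
      exact key (q 2) h2 hq2
  · refine ⟨fun i => ((((![((⟨1, hL⟩ : Fin L) : ℕ), 0, ((⟨0, hLpos⟩ : Fin L) : ℕ)] : Fin 3 → ℕ) i : ℝ) / L : ℝ) :
      UnitAddCircle), ?_, ?_, ?_⟩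
    · exact ((shearGrid_iff hLpos _).2 ⟨(⟨1, hL⟩, ⟨0, hLpos⟩), rfl⟩).1
    · exact ((shearGrid_iff hLpos _).2 ⟨(⟨1, hL⟩, ⟨0, hLpos⟩), rfl⟩).2
    · rw [mFourier_shearGrid q (⟨1, hL⟩, ⟨0, hLpos⟩)]
      simp only [Nat.cast_zero, mul_zero, zero_div, Complex.ofReal_zero, Complex.exp_zero, mul_one]
      exact key (q 0) h0 hq0

end Character

/-! ## The invariance defect as a bilinear form -/

section Defect

variable {m : ℕ} (S' : Finset (Fin 3 → ℤ)) (G : Fin m → (Fin 3 → ℤ) → EuclideanSpace ℂ (Fin 3))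
  (hC : Fin m → Fin m → ℂ) (e : (Fin 3 → ℤ) → ℂ)

/-- A linear form in the family: additivity. [folklore] -/
theorem twistSum_add (i : Fin m) (x x' : (Fin 3 → ℤ) → EuclideanSpace ℂ (Fin 3)) :
    (∑ k ∈ S', e (-k) * (WithLp.ofLp ((x + x') k) ⬝ᵥ WithLp.ofLp (G i (-k)))) =
      (∑ k ∈ S', e (-k) * (WithLp.ofLp (x k) ⬝ᵥ WithLp.ofLp (G i (-k)))) +
        ∑ k ∈ S', e (-k) * (WithLp.ofLp (x' k) ⬝ᵥ WithLp.ofLp (G i (-k))) := by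
  rw [← Finset.sum_add_distrib]
  exact Finset.sum_congr rfl fun k _ => by rw [Pi.add_apply, WithLp.ofLp_add, add_dotProduct, mul_add]

/-- A linear form in the family: homogeneity. [folklore] -/
theorem twistSum_smul (i : Fin m) (t : ℂ) (x : (Fin 3 → ℤ) → EuclideanSpace ℂ (Fin 3)) :
    (∑ k ∈ S', e (-k) * (WithLp.ofLp ((t • x) k) ⬝ᵥ WithLp.ofLp (G i (-k)))) =
      t * ∑ k ∈ S', e (-k) * (WithLp.ofLp (x k) ⬝ᵥ WithLp.ofLp (G i (-k))) := by
  rw [Finset.mul_sum]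
  exact Finset.sum_congr rfl fun k _ => by
    rw [Pi.smul_apply, WithLp.ofLp_smul, smul_dotProduct, smul_eq_mul]; ring

/-- The untwisted linear form: additivity. [folklore] -/
theorem plainSum_add (i : Fin m) (x x' : (Fin 3 → ℤ) → EuclideanSpace ℂ (Fin 3)) :
    (∑ k ∈ S', WithLp.ofLp ((x + x') k) ⬝ᵥ WithLp.ofLp (G i (-k))) =
      (∑ k ∈ S', WithLp.ofLp (x k) ⬝ᵥ WithLp.ofLp (G i (-k))) + ∑ k ∈ S', WithLp.ofLp (x' k) ⬝ᵥ WithLp.ofLp (G i (-k)) := by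
  rw [← Finset.sum_add_distrib]
  exact Finset.sum_congr rfl fun k _ => by rw [Pi.add_apply, WithLp.ofLp_add, add_dotProduct]

/-- The untwisted linear form: homogeneity. [folklore] -/
theorem plainSum_smul (i : Fin m) (t : ℂ) (x : (Fin 3 → ℤ) → EuclideanSpace ℂ (Fin 3)) :
    (∑ k ∈ S', WithLp.ofLp ((t • x) k) ⬝ᵥ WithLp.ofLp (G i (-k))) =
      t * ∑ k ∈ S', WithLp.ofLp (x k) ⬝ᵥ WithLp.ofLp (G i (-k)) := by
  rw [Finset.mul_sum]
  exact Finset.sum_congr rfl fun k _ => by rw [Pi.smul_apply, WithLp.ofLp_smul, smul_dotProduct, smul_eq_mul]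

/-- The defect form is additive in the first slot. [folklore] -/
theorem dd_add₁ (x x' y : (Fin 3 → ℤ) → EuclideanSpace ℂ (Fin 3)) :
    (∑ i, ∑ j, hC i j * ((∑ k ∈ S', e (-k) * (WithLp.ofLp ((x + x') k) ⬝ᵥ WithLp.ofLp (G i (-k)))) * (∑ k ∈ S', e (-k) * (WithLp.ofLp ((y) k) ⬝ᵥ WithLp.ofLp (G j (-k)))) - (∑ k ∈ S', WithLp.ofLp ((x + x') k) ⬝ᵥ WithLp.ofLp (G i (-k))) * (∑ k ∈ S', WithLp.ofLp ((y) k) ⬝ᵥ WithLp.ofLp (G j (-k))))) = (∑ i, ∑ j, hC i j * ((∑ k ∈ S', e (-k) * (WithLp.ofLp ((x) k) ⬝ᵥ WithLp.ofLp (G i (-k)))) * (∑ k ∈ S', e (-k) * (WithLp.ofLp ((y) k) ⬝ᵥ WithLp.ofLp (G j (-k)))) - (∑ k ∈ S', WithLp.ofLp ((x) k) ⬝ᵥ WithLp.ofLp (G i (-k))) * (∑ k ∈ S', WithLp.ofLp ((y) k) ⬝ᵥ WithLp.ofLp (G j (-k))))) + (∑ i, ∑ j, hC i j * ((∑ k ∈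 S', e (-k) * (WithLp.ofLp ((x') k) ⬝ᵥ WithLp.ofLp (G i (-k)))) * (∑ k ∈ S', e (-k) * (WithLp.ofLp ((y) k) ⬝ᵥ WithLp.ofLp (G j (-k)))) - (∑ k ∈ S', WithLp.ofLp ((x') k) ⬝ᵥ WithLp.ofLp (G i (-k))) * (∑ k ∈ S', WithLp.ofLp ((y) k) ⬝ᵥ WithLp.ofLp (G j (-k))))) := by
  rw [← Finset.sum_add_distrib]
  refine Finset.sum_congr rfl fun i _ => ?_
  rw [← Finset.sum_add_distrib]
  refine Finset.sum_congr rfl fun j _ => ?_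
  rw [twistSum_add, plainSum_add]
  ring

/-- The defect form is additive in the second slot. [folklore] -/
theorem dd_add₂ (x y y' : (Fin 3 → ℤ) → EuclideanSpace ℂ (Fin 3)) :
    (∑ i, ∑ j, hC i j * ((∑ k ∈ S', e (-k) * (WithLp.ofLp ((x) k) ⬝ᵥ WithLp.ofLp (G i (-k)))) * (∑ k ∈ S', e (-k) * (WithLp.ofLp ((y + y') k) ⬝ᵥ WithLp.ofLp (G j (-k)))) - (∑ k ∈ S', WithLp.ofLp ((x) k) ⬝ᵥ WithLp.ofLp (G i (-k))) * (∑ k ∈ S', WithLp.ofLp ((y + y') k) ⬝ᵥ WithLp.ofLp (G j (-k))))) = (∑ i, ∑ j, hC i j * ((∑ k ∈ S', e (-k) * (WithLp.ofLp ((x) k) ⬝ᵥ WithLp.ofLp (G i (-k)))) * (∑ k ∈ S', e (-k) * (WithLp.ofLp ((y) k) ⬝ᵥ WithLp.ofLp (G j (-k)))) - (∑ k ∈ S', WithLp.ofLp ((x) k) ⬝ᵥ WithLp.ofLp (G i (-k))) * (∑ k ∈ S', WithLp.ofLp ((y) k) ⬝ᵥ WithLp.ofLp (G j (-k))))) + (∑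 i, ∑ j, hC i j * ((∑ k ∈ S', e (-k) * (WithLp.ofLp ((x) k) ⬝ᵥ WithLp.ofLp (G i (-k)))) * (∑ k ∈ S', e (-k) * (WithLp.ofLp ((y') k) ⬝ᵥ WithLp.ofLp (G j (-k)))) - (∑ k ∈ S', WithLp.ofLp ((x) k) ⬝ᵥ WithLp.ofLp (G i (-k))) * (∑ k ∈ S', WithLp.ofLp ((y') k) ⬝ᵥ WithLp.ofLp (G j (-k))))) := by
  rw [← Finset.sum_add_distrib]
  refine Finset.sum_congr rfl fun i _ => ?_
  rw [← Finset.sum_add_distrib]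
  refine Finset.sum_congr rfl fun j _ => ?_
  rw [twistSum_add, plainSum_add]
  ring

/-- The defect form is homogeneous in the first slot. [folklore] -/
theorem dd_smul₁ (t : ℂ) (x y : (Fin 3 → ℤ) → EuclideanSpace ℂ (Fin 3)) :
    (∑ i, ∑ j, hC i j * ((∑ k ∈ S', e (-k) * (WithLp.ofLp ((t • x) k) ⬝ᵥ WithLp.ofLp (G i (-k)))) * (∑ k ∈ S', e (-k) * (WithLp.ofLp ((y) k) ⬝ᵥ WithLp.ofLp (G j (-k)))) - (∑ k ∈ S', WithLp.ofLp ((t • x) k) ⬝ᵥ WithLp.ofLp (G i (-k))) * (∑ k ∈ S', WithLp.ofLp ((y) k) ⬝ᵥ WithLp.ofLp (G j (-k))))) = t * (∑ i, ∑ j, hC i j * ((∑ k ∈ S', e (-k) * (WithLp.ofLp ((x) k) ⬝ᵥ WithLp.ofLp (G i (-k)))) * (∑ k ∈ S', e (-k) * (WithLp.ofLp ((y) k) ⬝ᵥ WithLp.ofLp (G j (-k)))) - (∑ k ∈ S', WithLp.ofLp ((x) k) ⬝ᵥ WithLp.ofLp (G i (-k))) * (∑ k ∈ S', WithLp.ofLp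 ((y) k) ⬝ᵥ WithLp.ofLp (G j (-k))))) := by
  simp only [twistSum_smul, plainSum_smul]
  rw [Finset.mul_sum Finset.univ]
  refine Finset.sum_congr rfl fun i _ => ?_
  rw [Finset.mul_sum Finset.univ]
  exact Finset.sum_congr rfl fun j _ => by ring

/-- The defect form is homogeneous in the second slot. [folklore] -/
theorem dd_smul₂ (t : ℂ) (x y : (Fin 3 → ℤ) → EuclideanSpace ℂ (Fin 3)) :
    (∑ i, ∑ j, hC i j * ((∑ k ∈ S', e (-k) * (WithLp.ofLp ((x) k) ⬝ᵥ WithLp.ofLp (G i (-k)))) * (∑ k ∈ S', e (-k) * (WithLp.ofLp ((t • y) k) ⬝ᵥ WithLp.ofLp (G j (-k)))) - (∑ k ∈ S', WithLp.ofLp ((x) k) ⬝ᵥ WithLp.ofLp (G i (-k))) * (∑ k ∈ S', WithLp.ofLp ((t • y) k) ⬝ᵥ WithLp.ofLp (G j (-k))))) = t * (∑ i, ∑ j, hC i j * ((∑ k ∈ S', e (-k) * (WithLp.ofLp ((x) k) ⬝ᵥ WithLp.ofLp (G i (-k)))) * (∑ k ∈ S', e (-k) * (WithLp.ofLp ((y)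 k) ⬝ᵥ WithLp.ofLp (G j (-k)))) - (∑ k ∈ S', WithLp.ofLp ((x) k) ⬝ᵥ WithLp.ofLp (G i (-k))) * (∑ k ∈ S', WithLp.ofLp ((y) k) ⬝ᵥ WithLp.ofLp (G j (-k))))) := by
  simp only [twistSum_smul, plainSum_smul]
  rw [Finset.mul_sum Finset.univ]
  refine Finset.sum_congr rfl fun i _ => ?_
  rw [Finset.mul_sum Finset.univ]
  exact Finset.sum_congr rfl fun j _ => by ring

/-- **The defect form on one-sided probes**: `D(δ_a v, δ_b w) = (e(-a) e(-b) - 1) · vᵀ Q_{a,b} w`.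
[folklore] -/
theorem dd_single {a b : Fin 3 → ℤ} (ha : a ∈ S') (hb : b ∈ S') (v w : Fin 3 → ℂ) :
    (∑ i, ∑ j, hC i j * ((∑ k ∈ S', e (-k) * (WithLp.ofLp (((Pi.single a (WithLp.toLp 2 v) : (Fin 3 → ℤ) → EuclideanSpace ℂ (Fin 3))) k) ⬝ᵥ WithLp.ofLp (G i (-k)))) * (∑ k ∈ S', e (-k) * (WithLp.ofLp (((Pi.single b (WithLp.toLp 2 w) : (Fin 3 → ℤ) → EuclideanSpace ℂ (Fin 3))) k) ⬝ᵥ WithLp.ofLp (G j (-k)))) - (∑ k ∈ S', WithLp.ofLp (((Pi.single a (WithLp.toLp 2 v) : (Fin 3 → ℤ) → EuclideanSpace ℂ (Fin 3))) k) ⬝ᵥ WithLp.ofLp (G i (-k))) * (∑ k ∈ S', WithLp.ofLp (((Pi.single b (WithLp.toLp 2 w) : (Fin 3 → ℤ) → EuclideanSpace ℂ (Fin 3))) k) ⬝ᵥ WithLp.ofLp (G j (-k))))) =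
      (e (-a) * e (-b) - 1) * (v ⬝ᵥ ((∑ i, ∑ j, hC i j • Matrix.vecMulVec (WithLp.ofLp (G i (-a)))
          (WithLp.ofLp (G j (-b)))) *ᵥ w)) := by
  have h1 : ∀ i, (∑ k ∈ S', e (-k) * (WithLp.ofLp ((Pi.single a (WithLp.toLp 2 v) :
      (Fin 3 → ℤ) → EuclideanSpace ℂ (Fin 3)) k) ⬝ᵥ WithLp.ofLp (G i (-k)))) = e (-a) * (v ⬝ᵥ WithLp.ofLp (G i (-a))) :=
    fun i => sum_apply_single ha (fun κ (u : EuclideanSpace ℂ (Fin 3)) => e (-κ) * (WithLp.ofLp u ⬝ᵥ WithLp.ofLp (G i (-κ))))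
      (fun κ => by simp) _
  have h2 : ∀ j, (∑ k ∈ S', e (-k) * (WithLp.ofLp ((Pi.single b (WithLp.toLp 2 w) :
      (Fin 3 → ℤ) → EuclideanSpace ℂ (Fin 3)) k) ⬝ᵥ WithLp.ofLp (G j (-k)))) = e (-b) * (w ⬝ᵥ WithLp.ofLp (G j (-b))) :=
    fun j => sum_apply_single hb (fun κ (u : EuclideanSpace ℂ (Fin 3)) => e (-κ) * (WithLp.ofLp u ⬝ᵥ WithLp.ofLp (G j (-κ))))
      (fun κ => by simp) _
  have h3 : ∀ i, (∑ k ∈ S', WithLp.ofLp ((Pi.single a (WithLp.toLp 2 v) :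
      (Fin 3 → ℤ) → EuclideanSpace ℂ (Fin 3)) k) ⬝ᵥ WithLp.ofLp (G i (-k))) = v ⬝ᵥ WithLp.ofLp (G i (-a)) :=
    fun i => sum_apply_single ha (fun κ (u : EuclideanSpace ℂ (Fin 3)) => WithLp.ofLp u ⬝ᵥ WithLp.ofLp (G i (-κ)))
      (fun κ => by simp) _
  have h4 : ∀ j, (∑ k ∈ S', WithLp.ofLp ((Pi.single b (WithLp.toLp 2 w) :
      (Fin 3 → ℤ) → EuclideanSpace ℂ (Fin 3)) k) ⬝ᵥ WithLp.ofLp (G j (-k))) = w ⬝ᵥ WithLp.ofLp (G j (-b)) :=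
    fun j => sum_apply_single hb (fun κ (u : EuclideanSpace ℂ (Fin 3)) => WithLp.ofLp u ⬝ᵥ WithLp.ofLp (G j (-κ)))
      (fun κ => by simp) _
  simp_rw [h1, h2, h3, h4]
  rw [AxialQuad.dotProduct_hessianBlock_mulVec, Finset.mul_sum Finset.univ]
  refine Finset.sum_congr rfl fun i _ => ?_
  rw [Finset.mul_sum Finset.univ]
  refine Finset.sum_congr rfl fun j _ => ?_
  rw [dotProduct_comm _ w]
  ring

/-- The polarisation lemma `bilinear_symm_sum_eq_zero`, specialised to coefficient families (so
that the algebraic instances in its statement are the pointwise ones). [folklore] -/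
theorem bilinear_symm_sum_eq_zero_fam
    (D : ((Fin 3 → ℤ) → EuclideanSpace ℂ (Fin 3)) → ((Fin 3 → ℤ) → EuclideanSpace ℂ (Fin 3)) → ℂ)
    (ha₁ : ∀ x x' y, D (x + x') y = D x y + D x' y) (ha₂ : ∀ x y y', D x (y + y') = D x y + D x y')
    (hs₁ : ∀ (t : ℂ) x y, D (t • x) y = t * D x y) (hs₂ : ∀ (t : ℂ) x y, D x (t • y) = t * D x y)
    (A : Set ((Fin 3 → ℤ) → EuclideanSpace ℂ (Fin 3))) (hA : ∀ a ∈ A, ∀ b ∈ A, a + b ∈ A)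
    (hF : ∀ a ∈ A, D a a = 0) {x y : (Fin 3 → ℤ) → EuclideanSpace ℂ (Fin 3)}
    (hx : ∃ x' ∈ A, ∃ x'' ∈ A, x = x' + Complex.I • x'') (hy : ∃ y' ∈ A, ∃ y'' ∈ A, y = y' + Complex.I • y'') :
    D x y + D y x = 0 :=
  AxialQuad.bilinear_symm_sum_eq_zero D ha₁ ha₂ hs₁ hs₂ A hA hF hx hy

/-- **Polarised defect on probes.** If the defect form vanishes on the diagonal of an additively
closed set `A` of families, then for one-sided probes that are complex combinations of members of
`A`: `(e(-a)e(-b) - 1) vᵀQ_{a,b}w + (e(-b)e(-a) - 1) wᵀQ_{b,a}v = 0`. [folklore] -/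
theorem dd_probe_vanish (A : Set ((Fin 3 → ℤ) → EuclideanSpace ℂ (Fin 3)))
    (hA : ∀ x ∈ A, ∀ y ∈ A, x + y ∈ A) (hinv : ∀ c ∈ A, (∑ i, ∑ j, hC i j * ((∑ k ∈ S', e (-k) * (WithLp.ofLp ((c) k) ⬝ᵥ WithLp.ofLp (G i (-k)))) * (∑ k ∈ S', e (-k) * (WithLp.ofLp ((c) k) ⬝ᵥ WithLp.ofLp (G j (-k)))) - (∑ k ∈ S', WithLp.ofLp ((c) k) ⬝ᵥ WithLp.ofLp (G i (-k))) * (∑ k ∈ S', WithLp.ofLp ((c) k) ⬝ᵥ WithLp.ofLp (G j (-k))))) = 0)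
    {a b : Fin 3 → ℤ} (ha : a ∈ S') (hb : b ∈ S') (v w : Fin 3 → ℂ)
    (hv : ∃ x' ∈ A, ∃ x'' ∈ A, (Pi.single a (WithLp.toLp 2 v) : (Fin 3 → ℤ) → EuclideanSpace ℂ (Fin 3)) =
      x' + Complex.I • x'')
    (hw : ∃ x' ∈ A, ∃ x'' ∈ A, (Pi.single b (WithLp.toLp 2 w) : (Fin 3 → ℤ) → EuclideanSpace ℂ (Fin 3)) =
      x' + Complex.I • x'') :
    (e (-a) * e (-b) - 1) * (v ⬝ᵥ ((∑ i, ∑ j, hC i j • Matrix.vecMulVec (WithLp.ofLp (G i (-a)))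
        (WithLp.ofLp (G j (-b)))) *ᵥ w)) +
      (e (-b) * e (-a) - 1) * (w ⬝ᵥ ((∑ i, ∑ j, hC i j • Matrix.vecMulVec (WithLp.ofLp (G i (-b)))
        (WithLp.ofLp (G j (-a)))) *ᵥ v)) = 0 := by
  have hsum := bilinear_symm_sum_eq_zero_fam (fun x y => (∑ i, ∑ j, hC i j * ((∑ k ∈ S', e (-k) * (WithLp.ofLp ((x) k) ⬝ᵥ WithLp.ofLp (G i (-k)))) * (∑ k ∈ S', e (-k) * (WithLp.ofLp ((y) k) ⬝ᵥ WithLp.ofLp (G j (-k)))) - (∑ k ∈ S', WithLp.ofLp ((x) k) ⬝ᵥ WithLp.ofLp (G i (-k))) * (∑ k ∈ S', WithLp.ofLp ((y) k) ⬝ᵥ WithLp.ofLp (G j (-k))))))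
    (dd_add₁ S' G hC e) (dd_add₂ S' G hC e) (dd_smul₁ S' G hC e) (dd_smul₂ S' G hC e) A hA hinv hv hw
  beta_reduce at hsum
  exact (congrArg₂ (· + ·) (dd_single S' G hC e ha hb v w).symm (dd_single S' G hC e hb ha w v).symm).trans hsum

end Defect

/-! ## Axiality of the Hessian blocks from shear invariance -/

section Axiality

/-- **The shifted observable's pairing, complex form**: for an admissible family `c`, a band test `g`
and `a : T³`, `Σ_{k∈S*} Re ⟪c k, 𝓕(g(·+a)) k⟫ = Σ_{k∈S*} e_{-k}(a) · (c(k) · ĝ(-k))`. [folklore] -/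
theorem twistedPairingSum_eq {N : ℕ} {c : (Fin 3 → ℤ) → EuclideanSpace ℂ (Fin 3)} (hc : Torus.IsConjSymm c)
    {g : UnitAddTorus (Fin 3) → EuclideanSpace ℝ (Fin 3)} (hg : IsBandTest N g) (a : UnitAddTorus (Fin 3)) :
    ∑ k ∈ (Torus.freqBall N).erase 0, (((inner ℂ (c k) (tcoef (fun x => g (x + a)) k)).re : ℝ) : ℂ) =
      ∑ k ∈ (Torus.freqBall N).erase 0, (UnitAddTorus.mFourier (-k) a : ℂ) *
        (WithLp.ofLp (c k) ⬝ᵥ WithLp.ofLp (tcoef g (-k))) := by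
  rw [AxialQuad.pairingSum_eq' neg_mem_freqBall_erase_zero hc
    (isConjSymm_tcoef ((hg.1.comp_add_right a).continuous.integrable_unitAddTorus))]
  refine Finset.sum_congr rfl fun k _ => ?_
  rw [show tcoef (fun x => g (x + a)) (-k) = (UnitAddTorus.mFourier (-k) a : ℂ) • tcoef g (-k) from
    mFourierCoeff_complexify_comp_add_right g a (-k), WithLp.ofLp_smul, dotProduct_smul, smul_eq_mul]

/-- **AXIALITY OF THE HESSIAN BLOCKS.** If the quadratic observable `P((·, g))` (band tests `g`,
`P` homogeneous of degree `2`) is invariant under the finite shear group `H_L` on level-`N` fields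
and `L > 2N`, then its Hessian block `Q a b` vanishes unless `(a + b)₀ = (a + b)₂ = 0`. [folklore] -/
theorem axial_of_axialObs {N L m : ℕ} (hNL : 2 * N < L)
    (g : Fin m → UnitAddTorus (Fin 3) → EuclideanSpace ℝ (Fin 3)) (hg : ∀ i, IsBandTest N (g i))
    (P : MvPolynomial (Fin m) ℝ) (hP : P.IsHomogeneous 2)
    (hObs : ∀ a : UnitAddTorus (Fin 3), a 1 = 0 → L • a = 0 → ∀ u : Torus.energySpace (Fin 3), IsLevel N u →
      MvPolynomial.eval (fun j => Torus.pairing u.1 (fun x => g j (x + a))) P =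
        MvPolynomial.eval (fun j => Torus.pairing u.1 (g j)) P)
    (a₀ b₀ : Fin 3 → ℤ) (hQ : (∑ i, ∑ j, (((MvPolynomial.pderiv j (MvPolynomial.pderiv i P)).coeff 0 : ℝ) : ℂ) • Matrix.vecMulVec (WithLp.ofLp (tcoef (g i) (-(a₀)))) (WithLp.ofLp (tcoef (g j) (-(b₀))))) ≠ 0) : (a₀ + b₀) 0 = 0 ∧ (a₀ + b₀) 2 = 0 := by
  by_contra hq
  -- both indices lie in the punctured ball
  have ha₀ : a₀ ∈ (Torus.freqBall N).erase 0 := by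
    by_contra h; exact hQ (hessianBlock_eq_zero_of_not_mem g P hg (Or.inl h))
  have hb₀ : b₀ ∈ (Torus.freqBall N).erase 0 := by
    by_contra h; exact hQ (hessianBlock_eq_zero_of_not_mem g P hg (Or.inr h))
  -- Nyquist: the momentum `-(a₀ + b₀)` is below `L`
  have hbd : ∀ i, |(-(a₀ + b₀)) i| < L := fun i => by
    have h1 := abs_apply_le_of_mem_freqBall (Finset.mem_of_mem_erase ha₀) i
    have h2 := abs_apply_le_of_mem_freqBall (Finset.mem_of_mem_erase hb₀) i
    have : |(-(a₀ + b₀)) i| ≤ |a₀ i| + |b₀ i| := by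
      rw [Pi.neg_apply, abs_neg, Pi.add_apply]; exact abs_add_le _ _
    have hNL' : (2 * N : ℤ) < L := by exact_mod_cast hNL
    linarith
  have hN1 : 1 ≤ N := by
    by_contra h
    have hN0 : N = 0 := by omega
    subst hN0
    refine (Finset.mem_erase.1 ha₀).1 (funext fun i => ?_)
    have := abs_apply_le_of_mem_freqBall (Finset.mem_of_mem_erase ha₀) i
    simpa using this
  have hL2 : 2 ≤ L := by omega
  obtain ⟨τ, hτ1, hτL, hne⟩ := exists_shear_char_ne_one hL2 (-(a₀ + b₀)) (hbd 0) (hbd 2)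
    (by simpa only [Pi.neg_apply, Pi.add_apply, neg_eq_zero] using hq)
  -- the invariance in coefficients, on admissible families
  set S' : Finset (Fin 3 → ℤ) := (Torus.freqBall N).erase 0 with hS'def
  have hS' : ∀ k ∈ S', -k ∈ S' := neg_mem_freqBall_erase_zero
  have hGcs : ∀ i, Torus.IsConjSymm (tcoef (g i)) := fun i =>
    isConjSymm_tcoef (hg i).1.continuous.integrable_unitAddTorus
  have hinv : ∀ c ∈ {c : (Fin 3 → ℤ) → EuclideanSpace ℂ (Fin 3) | Torus.IsConjSymm c ∧
      Torus.IsTransversal S' c ∧ ∀ k ∉ S', c k = 0},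
      (∑ i, ∑ j, (fun i j => (((MvPolynomial.pderiv j (MvPolynomial.pderiv i P)).coeff 0 : ℝ) : ℂ)) i j * ((∑ k ∈ S', (fun κ => (UnitAddTorus.mFourier κ τ : ℂ)) (-k) * (WithLp.ofLp ((c) k) ⬝ᵥ WithLp.ofLp ((fun i => tcoef (g i)) i (-k)))) * (∑ k ∈ S', (fun κ => (UnitAddTorus.mFourier κ τ : ℂ)) (-k) * (WithLp.ofLp ((c) k) ⬝ᵥ WithLp.ofLp ((fun i => tcoef (g i)) j (-k)))) - (∑ k ∈ S', WithLp.ofLp ((c) k) ⬝ᵥ WithLp.ofLp ((fun i => tcoef (g i)) i (-k))) * (∑ k ∈ S', WithLp.ofLp ((c) k) ⬝ᵥ WithLp.ofLp ((fun i => tcoef (g i)) j (-k))))) = 0 := by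
    rintro c ⟨hc, hT, hsupp⟩
    beta_reduce
    -- the real identity from `AxialObs`
    have hreal : MvPolynomial.eval (fun j => ∑ k ∈ S', (inner ℂ (c k) (tcoef (fun x => g j (x + τ)) k)).re) P =
        MvPolynomial.eval (fun j => ∑ k ∈ S', (inner ℂ (c k) (tcoef (g j) k)).re) P := by
      obtain ⟨u, hu, hcoef, -⟩ := exists_isLevel_coef_eq N c hc hT hsupp
      have h := hObs τ hτ1 hτL u hu
      rw [eval_pairing_eq_eval_coef u (fun j x => g j (x + τ)) (fun j => isBandTest_comp_add_right (hg j) τ) P,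
        eval_pairing_eq_eval_coef u g hg P] at h
      simp only [hcoef] at h
      exact h
    rw [AxialQuad.eval_of_isHomogeneous_two hP, AxialQuad.eval_of_isHomogeneous_two hP] at hreal
    have hreal' := congrArg (fun r : ℝ => (2 * r : ℂ)) hreal
    simp only [Complex.ofReal_mul, Complex.ofReal_inv, Complex.ofReal_ofNat, Complex.ofReal_sum] at hreal'
    have e1 : ∀ j, ∑ k ∈ S', (((inner ℂ (c k) (tcoef (fun x => g j (x + τ)) k)).re : ℝ) : ℂ) =
        ∑ k ∈ S', (UnitAddTorus.mFourier (-k) τ : ℂ) * (WithLp.ofLp (c k) ⬝ᵥ WithLp.ofLp (tcoef (g j) (-k))) :=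
      fun j => twistedPairingSum_eq hc (hg j) τ
    have e2 : ∀ j, ∑ k ∈ S', (((inner ℂ (c k) (tcoef (g j) k)).re : ℝ) : ℂ) =
        ∑ k ∈ S', WithLp.ofLp (c k) ⬝ᵥ WithLp.ofLp (tcoef (g j) (-k)) :=
      fun j => AxialQuad.pairingSum_eq' hS' hc (hGcs j)
    simp only [e1, e2] at hreal'
    rw [mul_inv_cancel_left₀ (two_ne_zero' ℂ), mul_inv_cancel_left₀ (two_ne_zero' ℂ), ← sub_eq_zero,
      ← Finset.sum_sub_distrib] at hreal'
    rw [← hreal']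
    refine Finset.sum_congr rfl fun i _ => ?_
    rw [← Finset.sum_sub_distrib]
    exact Finset.sum_congr rfl fun j _ => by ring
  -- polarisation and complexification on the probes
  have hA : ∀ a ∈ {c : (Fin 3 → ℤ) → EuclideanSpace ℂ (Fin 3) | Torus.IsConjSymm c ∧
      Torus.IsTransversal S' c ∧ ∀ k ∉ S', c k = 0}, ∀ b ∈ {c : (Fin 3 → ℤ) → EuclideanSpace ℂ (Fin 3) |
      Torus.IsConjSymm c ∧ Torus.IsTransversal S' c ∧ ∀ k ∉ S', c k = 0}, a + b ∈
      {c : (Fin 3 → ℤ) → EuclideanSpace ℂ (Fin 3) | Torus.IsConjSymm c ∧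
        Torus.IsTransversal S' c ∧ ∀ k ∉ S', c k = 0} := fun a ha b hb => AxialQuad.admissible_add ha hb
  have key : ∀ v w : Fin 3 → ℂ, v ⬝ᵥ (fun i : Fin 3 => (((a₀ : Fin 3 → ℤ) i : ℤ) : ℂ)) = 0 → w ⬝ᵥ (fun i : Fin 3 => (((b₀ : Fin 3 → ℤ) i : ℤ) : ℂ)) = 0 → v ⬝ᵥ ((∑ i, ∑ j, (((MvPolynomial.pderiv j (MvPolynomial.pderiv i P)).coeff 0 : ℝ) : ℂ) • Matrix.vecMulVec (WithLp.ofLp (tcoef (g i) (-(a₀)))) (WithLp.ofLp (tcoef (g j) (-(b₀))))) *ᵥ w) = 0 := by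
    intro v w hv hw
    have hsum' := dd_probe_vanish S' (fun i => tcoef (g i))
      (fun i j => (((MvPolynomial.pderiv j (MvPolynomial.pderiv i P)).coeff 0 : ℝ) : ℂ))
      (fun κ => (UnitAddTorus.mFourier κ τ : ℂ)) _ hA hinv ha₀ hb₀ v w
      (AxialQuad.probe_decomposition ha₀ hv) (AxialQuad.probe_decomposition hb₀ hw)
    beta_reduce at hsum'
    -- symmetry of the blocks: `wᵀ Q_{b,a} v = vᵀ Q_{a,b} w`
    have hsym : w ⬝ᵥ ((∑ i, ∑ j, (((MvPolynomial.pderiv j (MvPolynomial.pderiv i P)).coeff 0 : ℝ) : ℂ) • Matrix.vecMulVec (WithLp.ofLp (tcoef (g i) (-(b₀)))) (WithLp.ofLp (tcoef (g j) (-(a₀))))) *ᵥ v) = v ⬝ᵥ ((∑ i, ∑ j, (((MvPolynomial.pderiv j (MvPolynomial.pderiv i P)).coeff 0 : ℝ) : ℂ) • Matrix.vecMulVec (WithLp.ofLp (tcoef (g i) (-(a₀)))) (WithLp.ofLp (tcoef (g j) (-(b₀))))) *ᵥ w) := by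
      rw [hessianBlock_transpose g P a₀ b₀, Matrix.mulVec_transpose, dotProduct_comm, ← Matrix.dotProduct_mulVec]
    rw [hsym, mul_comm ((UnitAddTorus.mFourier (-b₀) τ : ℂ))] at hsum'
    have hE : (UnitAddTorus.mFourier (-a₀) τ : ℂ) * (UnitAddTorus.mFourier (-b₀) τ : ℂ) - 1 ≠ 0 := by
      rw [← UnitAddTorus.mFourier_add, ← neg_add, sub_ne_zero]; exact hne
    have h2 : ((UnitAddTorus.mFourier (-a₀) τ : ℂ) * (UnitAddTorus.mFourier (-b₀) τ : ℂ) - 1) *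
        (2 * (v ⬝ᵥ ((∑ i, ∑ j, (((MvPolynomial.pderiv j (MvPolynomial.pderiv i P)).coeff 0 : ℝ) : ℂ) • Matrix.vecMulVec (WithLp.ofLp (tcoef (g i) (-(a₀)))) (WithLp.ofLp (tcoef (g j) (-(b₀))))) *ᵥ w))) = 0 := by linear_combination hsum'
    exact (mul_eq_zero.1 ((mul_eq_zero.1 h2).resolve_left hE)).resolve_left two_ne_zero
  exact hQ (matrix_eq_zero_of_transverse_forms (Finset.mem_erase.1 ha₀).1 (Finset.mem_erase.1 hb₀).1 _
    (hessianBlock_row g P hg a₀ b₀) (hessianBlock_col g P hg a₀ b₀) key)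

end Axiality

end

end Summit.AnomalousDissipation.AnomalousDissipation.Theorems.MomentParityQuarticGate.AxialQuad

namespace Summit.AnomalousDissipation.AnomalousDissipation.Theorems.MomentParityQuarticGate

open Literature.Analysis.FunctionSpaces Literature.Analysis.FluidPDE
open Summit.AnomalousDissipation.AnomalousDissipation.Theorems.QuarticGate.Negative

-- the summit-side namespace repeats `AnomalousDissipation` by the tree's convention
set_option linter.dupNamespace false in
/-- **Registered sub-goal `axialQuad_axial` of stub S2q** (summary of this file): the Hessian blocks of a shear-invariant quadratic observable are axial. [folklore] -/
theorem axialQuad_axial : ∀ (N L m : ℕ), 2 * N < L → ∀ (g : Fin m → UnitAddTorus (Fin 3) → EuclideanSpace ℝ (Fin 3)), (∀ i, IsBandTest N (g i)) → ∀ (P : MvPolynomial (Fin m) ℝ), P.IsHomogeneous 2 → (∀ a : UnitAddTorus (Fin 3), a 1 = 0 → L • a = 0 → ∀ u : Torus.energySpace (Fin 3), IsLevel N u → MvPolynomial.eval (fun j => Torus.pairing u.1 (fun x => g j (x + a))) P = MvPolynomial.eval (fun j => Torus.pairing u.1 (g j)) P) → ∀ (a₀ b₀ : Fin 3 → ℤ),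 (∑ i, ∑ j, (((MvPolynomial.pderiv j (MvPolynomial.pderiv i P)).coeff 0 : ℝ) : ℂ) • Matrix.vecMulVec (WithLp.ofLp (tcoef (g i) (-(a₀)))) (WithLp.ofLp (tcoef (g j) (-(b₀))))) ≠ 0 → (a₀ + b₀) 0 = 0 ∧ (a₀ + b₀) 2 = 0 :=
  fun _ _ _ hNL g hg P hP hObs a₀ b₀ hQ => AxialQuad.axial_of_axialObs hNL g hg P hP hObs a₀ b₀ hQ

end Summit.AnomalousDissipation.AnomalousDissipation.Theorems.MomentParityQuarticGate
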